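import Summits.AtomisticToContinuum.BoseEinsteinCondensation.Theorems.BECThomsonPrincipleGDTransferLnssAlgebra
import Literature.MathematicalPhysics.QuantumManyBody.PeriodicTorusByParts

/-!
# Route `BECThomsonPrinciple`, crux `GDTransfer` (stmt-AtomisticToContinuum-9482), line `dyson-dressed-witness`:
# stub `bareSecondVariation`, part 1 — adjointness of the LNSS pair; one derivative through `P_i`, `P_i^{(n)}`

Support file of `stub_bareSecondVariation` (the second variation of the periodic energy form along the
Lewin–Nam–Serfaty–Solovej directions `Λ_n†Ψ = lnssUpper`, `Λ_nΨ = lnssLower` of the line's `Defs` module).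
Two reusable inputs of the double-commutator bookkeeping, valid for arbitrary continuous / `C¹` periodic
functions (not only trial states):
* **adjointness** `∫ conj(f) Λ_n† g = ∫ conj(Λ_n f) g` on continuous `f, g` (`integral_conj_mul_lnssUpper`;
  slot-wise `∫ conj(f) e_n(x_i) P_i R = ∫ conj(P_i^{(n)} f) R` from part (L2) of `stub_lnssAlgebra`, and
  self-adjointness of `R = n̂₀^{-1/2}`);
* **one derivative under the slot integrals** `X ↦ ∫_cell w(y) h(X[i ↦ y]) dy` over the bounded cell
  (`hasFDerivAt_parametric_setIntegral`): `∂_v (P_i h) = L⁻³∫ Dh(X[i↦y])(v[i↦0]) dy` and the same for the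
  flat Fourier coefficient `P_i^{(n)}`; hence `P_i h`, `P_i^{(n)} h` are flat in slot `i`, `∂_{j,a}` passes under
  `P_i`, `P_i^{(n)}` for `j ≠ i`, `P_i ∂_{i,a} = 0` and `P_i^{(n)} ∂_{i,a} = (2πi n_a/L) P_i^{(n)}` on periodic `C¹`
  functions (integration by parts on the torus, `cellFourierCoeff_fderiv`), so that `∂_{j,a}` commutes with
  every `P_i` on periodic `C¹` functions (`fderiv_cellAvg_single`).
All [folklore] (arXiv:1211.2778 §2; LSSY2005 App. A).
-/

noncomputable section

open MeasureTheory Filter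
open scoped ENNReal NNReal ComplexConjugate

namespace Summit.AtomisticToContinuum.BoseEinsteinCondensation.Cruxes.GDTransfer.DysonDressedWitness

namespace SecondVariation

open Literature.MathematicalPhysics.QuantumManyBody.BoseGas
open Summit.AtomisticToContinuum.BoseEinsteinCondensation.Theorems.GaussianDominationCan.Negative
open ChordVariation (continuous_modeProj)
open Lnss

variable {N m : ℕ} {L : ℝ}

/-! ## Adjointness `⟨f, Λ_n† g⟩ = ⟨Λ_n f, g⟩` on continuous functions -/

/-- **The LNSS creator is the adjoint of the LNSS annihilator** on continuous functions:
`∫ conj(f) · Λ_n† g = ∫ conj(Λ_n f) · g` over `cell^N` (slot-wise adjointness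
`∫ conj(f) e_n(x_i) P_i R = ∫ conj(P_i^{(n)} f) R` and self-adjointness of `n̂₀^{-1/2}`). [folklore] -/
theorem integral_conj_mul_lnssUpper (n : Fin 3 → ℤ) {f g : Config (m + 1) → ℂ}
    (hf : Continuous f) (hg : Continuous g) :
    ∫ X in cellN (m + 1) L, conj (f X) * lnssUpper m L n g X =
      ∫ X in cellN (m + 1) L, conj (lnssLower m L n f X) * g X := by
  have hRc : Continuous (rootInv m L g) := continuous_rootInv hg
  have hint : ∀ i ∈ (Finset.univ : Finset (Fin (m + 1))), Integrable
      (fun X => conj (f X) * (cellWave L n (X i) * cellAvg (m + 1) L i (rootInv m L g) X))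
      ((volume : Measure (Config (m + 1))).restrict (cellN (m + 1) L)) := fun i _ =>
    integrableOn_cellN ((Complex.continuous_conj.comp hf).mul
      (((continuous_cellWave L n).comp (continuous_apply i)).mul (continuous_cellAvg i hRc))) L
  have hint' : ∀ i ∈ (Finset.univ : Finset (Fin (m + 1))), Integrable
      (fun X => conj (fourierAvg m L n i f X) * rootInv m L g X)
      ((volume : Measure (Config (m + 1))).restrict (cellN (m + 1) L)) := fun i _ =>
    integrableOn_cellN ((Complex.continuous_conj.comp (continuous_fourierAvg n i hf)).mul hRc) L
  calc ∫ X in cellN (m + 1) L, conj (f X) * lnssUpper m L n g X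
      = ∫ X in cellN (m + 1) L, ∑ i : Fin (m + 1), conj (f X) *
          (cellWave L n (X i) * cellAvg (m + 1) L i (rootInv m L g) X) := by
        refine integral_congr_ae (Eventually.of_forall fun X => ?_)
        simp only [lnssUpper, Finset.mul_sum]
    _ = ∑ i : Fin (m + 1), ∫ X in cellN (m + 1) L, conj (f X) *
          (cellWave L n (X i) * cellAvg (m + 1) L i (rootInv m L g) X) := integral_finsetSum _ hint
    _ = ∑ i : Fin (m + 1), ∫ X in cellN (m + 1) L,
          conj (fourierAvg m L n i f X) * rootInv m L g X :=
        Finset.sum_congr rfl fun i _ => integral_slot_eq_inner_fourierAvg n i hf hRc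
    _ = ∫ X in cellN (m + 1) L, ∑ i : Fin (m + 1),
          conj (fourierAvg m L n i f X) * rootInv m L g X := (integral_finsetSum _ hint').symm
    _ = ∫ X in cellN (m + 1) L, conj (∑ i : Fin (m + 1), fourierAvg m L n i f X) *
          rootInv m L g X := by
        refine integral_congr_ae (Eventually.of_forall fun X => ?_)
        simp only [map_sum, Finset.sum_mul]
    _ = ∫ X in cellN (m + 1) L, conj (lnssLower m L n f X) * g X :=
        integral_conj_mul_rootInv (continuous_sum_fourierAvg n hf) hg


/-! ## One derivative of the slot integrals `X ↦ ∫_cell w(y) h(X[i ↦ y]) dy` -/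

/-- The continuous linear map `Π_j (j = i ? 0 : proj_j)` is `v ↦ v[i ↦ 0]` (kill slot `i`). [folklore] -/
theorem pi_ite_proj_apply (i : Fin N) (v : Config N) :
    (ContinuousLinearMap.pi fun j : Fin N =>
        if j = i then (0 : Config N →L[ℝ] Space) else ContinuousLinearMap.proj j) v =
      Function.update v i 0 := by
  funext j
  rw [ContinuousLinearMap.pi_apply]
  rcases eq_or_ne j i with rfl | hj
  · simp
  · simp [hj]

/-- The affine map `X ↦ X[i ↦ y]` (`y` fixed) has derivative `v ↦ v[i ↦ 0]`. [folklore] -/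
theorem hasFDerivAt_update_left (i : Fin N) (y : Space) (X : Config N) :
    HasFDerivAt (fun X' : Config N => Function.update X' i y)
      (ContinuousLinearMap.pi fun j : Fin N =>
        if j = i then (0 : Config N →L[ℝ] Space) else ContinuousLinearMap.proj j) X := by
  have h : HasFDerivAt (fun (X' : Config N) (j : Fin N) => Function.update X' i y j)
      (ContinuousLinearMap.pi fun j : Fin N =>
        if j = i then (0 : Config N →L[ℝ] Space) else ContinuousLinearMap.proj j) X := by
    refine hasFDerivAt_pi.2 fun j => ?_
    rcases eq_or_ne j i with rfl | hj
    · simp only [Function.update_self, if_true]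
      exact hasFDerivAt_const y X
    · simp only [Function.update_of_ne hj, if_neg hj]
      exact hasFDerivAt_apply j X
  exact h

/-- The slot integral `X ↦ ∫_cell w(y) h(X[i ↦ y]) dy` of `C¹` data is differentiable, with derivative
the integral of the partial derivative (one derivative under the integral over the bounded cell). [folklore] -/
theorem hasFDerivAt_slotIntegral (i : Fin N) {w : Space → ℂ} (hw : ContDiff ℝ 1 w)
    {h : Config N → ℂ} (hh : ContDiff ℝ 1 h) (X : Config N) :
    HasFDerivAt (fun X' : Config N => ∫ y in cell L, w y * h (Function.update X' i y))
      (∫ y in cell L, (fderiv ℝ (fun q : Space × Config N => w q.1 * h (Function.update q.2 i q.1))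
        (y, X)).comp (ContinuousLinearMap.inr ℝ Space (Config N))) X := by
  have hHd : ContDiff ℝ 1 (fun q : Space × Config N => w q.1 * h (Function.update q.2 i q.1)) :=
    (hw.comp contDiff_fst).mul (hh.comp (contDiff_update_slot i))
  exact Literature.Analysis.FunctionSpaces.hasFDerivAt_parametric_setIntegral (μ := volume)
    (isBounded_cell L) (measurableSet_cell L) hHd one_ne_zero X

/-- **One derivative under the slot integral**: for `C¹` data `w`, `h`,
`∂_v [∫_cell w(y) h(X[i ↦ y]) dy] = ∫_cell w(y) Dh(X[i ↦ y]) (v[i ↦ 0]) dy`. [folklore] -/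
theorem fderiv_slotIntegral_apply (i : Fin N) {w : Space → ℂ} (hw : ContDiff ℝ 1 w)
    {h : Config N → ℂ} (hh : ContDiff ℝ 1 h) (X v : Config N) :
    fderiv ℝ (fun X' : Config N => ∫ y in cell L, w y * h (Function.update X' i y)) X v =
      ∫ y in cell L, w y * fderiv ℝ h (Function.update X i y) (Function.update v i 0) := by
  set H : Space × Config N → ℂ := fun q => w q.1 * h (Function.update q.2 i q.1) with hH
  have hHd : ContDiff ℝ 1 H := (hw.comp contDiff_fst).mul (hh.comp (contDiff_update_slot i))
  have hd := hasFDerivAt_slotIntegral (L := L) i hw hh X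
  -- the integrand of the derivative is continuous in `y`, hence integrable on the cell
  have hDc : Continuous (fderiv ℝ H) := hHd.continuous_fderiv one_ne_zero
  have hF'c : Continuous fun y : Space =>
      (fderiv ℝ H (y, X)).comp (ContinuousLinearMap.inr ℝ Space (Config N)) :=
    ((ContinuousLinearMap.compL ℝ (Config N) (Space × Config N) ℂ).flip
      (ContinuousLinearMap.inr ℝ Space (Config N))).continuous.comp
      (hDc.comp (continuous_id.prodMk continuous_const))
  have hint : Integrable (fun y : Space =>
      (fderiv ℝ H (y, X)).comp (ContinuousLinearMap.inr ℝ Space (Config N)))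
      ((volume : Measure Space).restrict (cell L)) := integrableOn_cell hF'c
  -- the slice derivative
  have hslice : ∀ y : Space,
      (fderiv ℝ H (y, X)).comp (ContinuousLinearMap.inr ℝ Space (Config N)) v =
        w y * fderiv ℝ h (Function.update X i y) (Function.update v i 0) := by
    intro y
    have h1 : HasFDerivAt (fun X' : Config N => H (y, X'))
        ((fderiv ℝ H (y, X)).comp (ContinuousLinearMap.inr ℝ Space (Config N))) X :=
      (hHd.differentiable one_ne_zero (y, X)).hasFDerivAt.comp X (hasFDerivAt_prodMk_right y X)
    have h2 : HasFDerivAt (fun X' : Config N => H (y, X'))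
        (w y • (fderiv ℝ h (Function.update X i y)).comp
          (ContinuousLinearMap.pi fun j : Fin N =>
            if j = i then (0 : Config N →L[ℝ] Space) else ContinuousLinearMap.proj j)) X := by
      have h3 : HasFDerivAt (fun X' : Config N => h (Function.update X' i y))
          ((fderiv ℝ h (Function.update X i y)).comp
            (ContinuousLinearMap.pi fun j : Fin N =>
              if j = i then (0 : Config N →L[ℝ] Space) else ContinuousLinearMap.proj j)) X :=
        (hh.differentiable one_ne_zero _).hasFDerivAt.comp X (hasFDerivAt_update_left i y X)
      exact h3.const_mul (w y)
    rw [h1.unique h2, FunLike.coe_smul, Pi.smul_apply, ContinuousLinearMap.comp_apply,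
      pi_ite_proj_apply, smul_eq_mul]
  rw [hd.fderiv, ContinuousLinearMap.integral_apply hint v]
  exact integral_congr_ae (Eventually.of_forall hslice)

/-! ## `∂` through `P_i` and `P_i^{(n)}` -/

/-- `v[i ↦ 0] = 0` for `v = Pi.single i u`. [folklore] -/
theorem update_single_self_zero (i : Fin N) (u : Space) :
    Function.update (Pi.single i u : Config N) i 0 = 0 := by
  funext j
  rcases eq_or_ne j i with rfl | hj
  · simp
  · simp [hj]

/-- `v[i ↦ 0] = v` for `v = Pi.single j u`, `j ≠ i`. [folklore] -/
theorem update_single_of_ne {i j : Fin N} (hji : j ≠ i) (u : Space) :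
    Function.update (Pi.single j u : Config N) i 0 = Pi.single j u := by
  funext l
  rcases eq_or_ne l i with rfl | hl
  · simp [hji.symm]
  · simp [hl]

/-- The slice derivative: `∂_u [y ↦ h(X[i ↦ y])] = Dh(X[i ↦ y]) (Pi.single i u)`. [folklore] -/
theorem fderiv_comp_update_apply (i : Fin N) {h : Config N → ℂ} (hh : Differentiable ℝ h)
    (X : Config N) (y u : Space) :
    fderiv ℝ (fun z : Space => h (Function.update X i z)) y u =
      fderiv ℝ h (Function.update X i y) (Pi.single i u) := by
  have h1 : HasFDerivAt (fun z : Space => h (Function.update X i z))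
      ((fderiv ℝ h (Function.update X i y)).comp
        (ContinuousLinearMap.pi (Pi.single i (ContinuousLinearMap.id ℝ Space)))) y :=
    (hh _).hasFDerivAt.comp y (hasFDerivAt_update X y)
  rw [h1.fderiv, ContinuousLinearMap.comp_apply, pi_single_id_apply]

/-- **Derivative of `P_i h`** in a general direction:
`∂_v (P_i h)(X) = L⁻³ ∫_cell Dh(X[i ↦ y]) (v[i ↦ 0]) dy`. [folklore] -/
theorem fderiv_cellAvg_apply (i : Fin N) {h : Config N → ℂ} (hh : ContDiff ℝ 1 h) (X v : Config N) :
    fderiv ℝ (cellAvg N L i h) X v =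
      ((L ^ 3)⁻¹ : ℝ) • ∫ y in cell L, fderiv ℝ h (Function.update X i y) (Function.update v i 0) := by
  have hw : ContDiff ℝ 1 (fun _ : Space => (1 : ℂ)) := contDiff_const
  have hslot := fderiv_slotIntegral_apply (L := L) i hw hh X v
  have hd := (hasFDerivAt_slotIntegral (L := L) i hw hh X).differentiableAt
  simp only [one_mul] at hslot hd
  show fderiv ℝ (fun X' => ((L ^ 3)⁻¹ : ℝ) • ∫ y in cell L, h (Function.update X' i y)) X v = _
  rw [fderiv_fun_const_smul hd, FunLike.coe_smul, Pi.smul_apply, hslot]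

/-- `P_i h` is flat in slot `i`: `∂_{Pi.single i u} (P_i h) = 0`. [folklore] -/
theorem fderiv_cellAvg_single_self (i : Fin N) {h : Config N → ℂ} (hh : ContDiff ℝ 1 h)
    (X : Config N) (u : Space) :
    fderiv ℝ (cellAvg N L i h) X (Pi.single i u) = 0 := by
  rw [fderiv_cellAvg_apply i hh, update_single_self_zero]
  simp

/-- `∂` along another slot passes under `P_i`: `∂_{Pi.single j u}(P_i h) = P_i(∂_{Pi.single j u} h)`,
`j ≠ i`. [folklore] -/
theorem fderiv_cellAvg_single_of_ne {i j : Fin N} (hji : j ≠ i) {h : Config N → ℂ}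
    (hh : ContDiff ℝ 1 h) (X : Config N) (u : Space) :
    fderiv ℝ (cellAvg N L i h) X (Pi.single j u) =
      cellAvg N L i (fun Y => fderiv ℝ h Y (Pi.single j u)) X := by
  rw [fderiv_cellAvg_apply i hh, update_single_of_ne hji]
  rfl

/-- `P_i` kills slot-`i` derivatives of periodic functions: `P_i(∂_{i,a} h) = 0` (`∫_cell ∂ = 0` on the
torus). [folklore] -/
theorem cellAvg_fderiv_single_self (hL : 0 < L) (i : Fin N) {h : Config N → ℂ} (hh : ContDiff ℝ 1 h)
    (hper : ∀ (X : Config N) (j : Fin N) (k : Fin 3),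
      h (X + Pi.single j (EuclideanSpace.single k L)) = h X)
    (a : Fin 3) (X : Config N) :
    cellAvg N L i (fun Y => fderiv ℝ h Y (Pi.single i (EuclideanSpace.single a 1))) X = 0 := by
  set ψ : Space → ℂ := fun z => h (Function.update X i z) with hψ
  have hψC : ContDiff ℝ 1 ψ := hh.comp ((contDiff_update_slot i).comp
    (contDiff_id.prodMk contDiff_const))
  have hψper : ∀ (z : Space) (k : Fin 3), ψ (z + EuclideanSpace.single k L) = ψ z := by
    intro z k
    simp only [hψ, update_add_eq, hper]
  have h0 := integral_cell_fderiv_eq_zero hL hψC hψper a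
  have hpt : ∀ z : Space, fderiv ℝ ψ z (EuclideanSpace.single a 1) =
      fderiv ℝ h (Function.update X i z) (Pi.single i (EuclideanSpace.single a 1)) := fun z =>
    fderiv_comp_update_apply i (hh.differentiable one_ne_zero) X z _
  simp_rw [hpt] at h0
  unfold cellAvg
  rw [h0, smul_zero]

/-- **`∂_{j,a}` commutes with `P_i` on periodic `C¹` functions** (all `i, j`). [folklore] -/
theorem fderiv_cellAvg_single (hL : 0 < L) (i j : Fin N) (a : Fin 3) {h : Config N → ℂ}
    (hh : ContDiff ℝ 1 h)
    (hper : ∀ (X : Config N) (j : Fin N) (k : Fin 3),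
      h (X + Pi.single j (EuclideanSpace.single k L)) = h X)
    (X : Config N) :
    fderiv ℝ (cellAvg N L i h) X (Pi.single j (EuclideanSpace.single a 1)) =
      cellAvg N L i (fun Y => fderiv ℝ h Y (Pi.single j (EuclideanSpace.single a 1))) X := by
  rcases eq_or_ne j i with rfl | hji
  · rw [fderiv_cellAvg_single_self j hh, cellAvg_fderiv_single_self hL j hh hper]
  · exact fderiv_cellAvg_single_of_ne hji hh X _

/-- **Derivative of `P_i^{(n)} h`** in a general direction:
`∂_v (P_i^{(n)} h)(X) = L⁻³ ∫_cell conj(e_n(y)) Dh(X[i ↦ y]) (v[i ↦ 0]) dy`. [folklore] -/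
theorem fderiv_fourierAvg_apply (n : Fin 3 → ℤ) (i : Fin (m + 1)) {h : Config (m + 1) → ℂ}
    (hh : ContDiff ℝ 1 h) (X v : Config (m + 1)) :
    fderiv ℝ (fourierAvg m L n i h) X v =
      ((L ^ 3)⁻¹ : ℝ) • ∫ y in cell L, conj (cellWave L n y) *
        fderiv ℝ h (Function.update X i y) (Function.update v i 0) := by
  have hw : ContDiff ℝ 1 fun y : Space => conj (cellWave L n y) :=
    Complex.conjCLE.contDiff.comp ((contDiff_cellWave L n).of_le (mod_cast le_top))
  have hslot := fderiv_slotIntegral_apply (L := L) i hw hh X v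
  have hd := (hasFDerivAt_slotIntegral (L := L) i hw hh X).differentiableAt
  show fderiv ℝ (fun X' => ((L ^ 3)⁻¹ : ℝ) •
    ∫ y in cell L, conj (cellWave L n y) * h (Function.update X' i y)) X v = _
  rw [fderiv_fun_const_smul hd, FunLike.coe_smul, Pi.smul_apply, hslot]

/-- `P_i^{(n)} h` is flat in slot `i`: `∂_{Pi.single i u} (P_i^{(n)} h) = 0`. [folklore] -/
theorem fderiv_fourierAvg_single_self (n : Fin 3 → ℤ) (i : Fin (m + 1)) {h : Config (m + 1) → ℂ}
    (hh : ContDiff ℝ 1 h) (X : Config (m + 1)) (u : Space) :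
    fderiv ℝ (fourierAvg m L n i h) X (Pi.single i u) = 0 := by
  rw [fderiv_fourierAvg_apply n i hh, update_single_self_zero]
  simp

/-- `∂` along another slot passes under `P_i^{(n)}`. [folklore] -/
theorem fderiv_fourierAvg_single_of_ne (n : Fin 3 → ℤ) {i j : Fin (m + 1)} (hji : j ≠ i)
    {h : Config (m + 1) → ℂ} (hh : ContDiff ℝ 1 h) (X : Config (m + 1)) (u : Space) :
    fderiv ℝ (fourierAvg m L n i h) X (Pi.single j u) =
      fourierAvg m L n i (fun Y => fderiv ℝ h Y (Pi.single j u)) X := by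
  rw [fderiv_fourierAvg_apply n i hh, update_single_of_ne hji]
  rfl

/-- **The derivative rule in slot `i`**: `P_i^{(n)}(∂_{i,a} h) = (2πi n_a/L) P_i^{(n)} h` for periodic
`C¹` `h` (one integration by parts on the torus, `cellFourierCoeff_fderiv`). [folklore] -/
theorem fourierAvg_fderiv_single_self (hL : 0 < L) (n : Fin 3 → ℤ) (i : Fin (m + 1))
    {h : Config (m + 1) → ℂ} (hh : ContDiff ℝ 1 h)
    (hper : ∀ (X : Config (m + 1)) (j : Fin (m + 1)) (k : Fin 3),
      h (X + Pi.single j (EuclideanSpace.single k L)) = h X)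
    (a : Fin 3) (X : Config (m + 1)) :
    fourierAvg m L n i (fun Y => fderiv ℝ h Y (Pi.single i (EuclideanSpace.single a 1))) X =
      (2 * Real.pi * Complex.I * (n a) / L) * fourierAvg m L n i h X := by
  set ψ : Space → ℂ := fun z => h (Function.update X i z) with hψ
  have hψC : ContDiff ℝ 1 ψ := hh.comp ((contDiff_update_slot i).comp
    (contDiff_id.prodMk contDiff_const))
  have hψper : ∀ (z : Space) (k : Fin 3), ψ (z + EuclideanSpace.single k L) = ψ z := by
    intro z k
    simp only [hψ, update_add_eq, hper]
  have key := cellFourierCoeff_fderiv hL hψC hψper a n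
  have hpt : ∀ z : Space, fderiv ℝ ψ z (EuclideanSpace.single a 1) =
      fderiv ℝ h (Function.update X i z) (Pi.single i (EuclideanSpace.single a 1)) := fun z =>
    fderiv_comp_update_apply i (hh.differentiable one_ne_zero) X z _
  simp_rw [hpt] at key
  rw [cellFourierCoeff_eq_integral hL, cellFourierCoeff_eq_integral hL] at key
  exact key

end SecondVariation

open Literature.MathematicalPhysics.QuantumManyBody.BoseGas in
/-- **Part 1 of `stub_bareSecondVariation` (registered helper statement)**: the LNSS creator `Λ_n†` is the
adjoint of the LNSS annihilator `Λ_n` on continuous functions, `∫ conj(f) Λ_n† g = ∫ conj(Λ_n f) g` over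
`cell^N`. [folklore] -/
theorem bareSecondVariation_lnss_adjoint :
    ∀ (m : ℕ) (L : ℝ) (n : Fin 3 → ℤ)
      (f g : Literature.MathematicalPhysics.QuantumManyBody.BoseGas.Config (m + 1) → ℂ),
      Continuous f → Continuous g →
        ∫ X in Literature.MathematicalPhysics.QuantumManyBody.BoseGas.cellN (m + 1) L,
            conj (f X) * lnssUpper m L n g X =
          ∫ X in Literature.MathematicalPhysics.QuantumManyBody.BoseGas.cellN (m + 1) L,
            conj (lnssLower m L n f X) * g X :=
  fun _ _ n _ _ hf hg => SecondVariation.integral_conj_mul_lnssUpper n hf hg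

end Summit.AtomisticToContinuum.BoseEinsteinCondensation.Cruxes.GDTransfer.DysonDressedWitness

end
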